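import Literature.AlgebraicGeometry.HodgeTheory.BlochSemiregularSpread
import Literature.AlgebraicGeometry.HodgeTheory.AlgebraicityLocus
import Literature.AlgebraicGeometry.Motives.VeryGeneralComplexPoint
import HarnessLib

/-!
# Bloch's semiregularity theorem, global form: a semiregular representative makes the class algebraic on
# the WHOLE irreducible base (Bloch 1972, Thm. (7.4) and the last paragraph of its proof) — proved from
# the tree's named facts

Family `hodge`, layer `Literature/AlgebraicGeometry/HodgeTheory`. THEOREMS ONLY (no definition, no new
named fact; D-0026): the class-level GLOBAL conclusion of Bloch's variational theorem, assembled from the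
tree's two named facts `BlochSemiregularSpread` (`BlochSemiregularSpread.lean`: Bloch 1972 /
Buchweitz–Flenner 2003 Thm. 5.2, "`α_p(s)` is algebraic for all `s ∈ S` NEAR `0`") and
`charlesSchnell_algebraicityLocus_iUnion_closed` (`AlgebraicityLocus.lean`: the algebraicity locus of a
global class is a countable union of Zariski-closed subsets of the base), plus Baire's theorem on
`S(ℂ)` in the proved form `Motives.ComplexPoints.dense_setOf_forall_pt_not_mem`
(`Motives/VeryGeneralComplexPoint.lean`). Written for the cell `pub-hsemireg` (arrow "semiregular
representative at one point ⇒ the class is algebraic along the whole Hodge-locus component"), where the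
local statement of BF Thm. 5.2 is not enough.

## Source, verbatim (S. Bloch, *Semi-regularity and de Rham cohomology*, Invent. Math. 17 (1972) 51–66;
## open GDZ digitisation PPN356556735_0017/LOG_0011, page images read 2026-08-22)

p. 65: "**(7.4) Theorem.** Let `X →ᶠ S →ᵍ Spec(ℂ)` be morphisms, with `f` smooth and projective and `g`
smooth, connected, and of finite type. Let `z ∈ Γ(S, R^{2p} f_*(Ω•_{X/S}))` be a horizontal section and
let `o ∈ S`. Suppose the restricted class `z₀ ∈ H^{2p}_{DR}(X₀/ℂ)` is algebraic, representing a local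
complete intersection, `Z₀ ⊂ X₀` which is semi-regular in `X₀`. Then for all `s ∈ S`,
`z_s ∈ H^{2p}_{DR}(X_s/ℂ)` is algebraic." Proof, last paragraph (p. 65, after the lift over a complex
neighbourhood `U` of `o` has been obtained from (7.1) and Artin's theorem): "Hence `Z₀` lifts to an
analytic family over `U`, so `z_s` is algebraic for `s ∈ U`. A simple argument using the Hilbert scheme
shows `T = {s ∈ S | z_s is algebraic}` is contained in a countable union of closed subvarieties of
`S`. Since `U ⊂ T`, it follows that `T = S`, proving (7.4)." (7.5) Remark: "The hypothesis on `z₀` in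
(7.4) can be weakened to read: there exist integers `a, b`, `a ≠ 0`, such that `a z₀ + b l₀^p` is the
class of a subscheme `Z₀ ⊂ X₀` which is semi-regular and a local complete intersection."

Buchweitz–Flenner 2003 (Compositio Math. 137, p. 175), Thm. 5.2, conclude only "`α_p(s)` is algebraic for
all `s ∈ S` near `0`" over a smooth germ; the tree's `BlochSemiregularSpread` renders exactly that
("for all `t` in an open neighbourhood of `s₀` in `S(ℂ)`"). The present file supplies Bloch's last
paragraph on the tree's carriers: the "countable union of closed subvarieties" is the named fact
`charlesSchnell_algebraicityLocus_iUnion_closed` (Charles–Schnell, proof of Prop. 11.3.11; Voisin,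
*Hodge Theory II*, §3.3.1 — the same relative-Hilbert-scheme argument Bloch alludes to), and "Since
`U ⊂ T`, it follows that `T = S`" is Baire's theorem on the locally compact Hausdorff space `S(ℂ)`
together with the density of `(S ∖ W)(ℂ)` for a proper Zariski-closed `W` of the IRREDUCIBLE `S`
(Bloch's "`g` smooth, connected": a smooth connected scheme of finite type over a field is irreducible;
irreducibility is what is used, and it is the hypothesis taken here).

## What is proved

* `Motives.ComplexPoints.exists_eq_univ_of_isOpen_subset_iUnion` — for `S` irreducible, separated and
  locally of finite type over `ℂ`: if a non-empty analytic-open `U ⊆ S(ℂ)` is contained in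
  `⋃ⱼ Wⱼ(ℂ)` for countably many Zariski-closed `Wⱼ ⊆ S`, then some `Wⱼ = S` ("Since `U ⊂ T`, it
  follows that `T = S`").
* `charlesSchnell_algebraicityLocus_iUnion_closed.forall_mem_algebraicClasses_of_isOpen` — granted the
  algebraicity-locus fact: for a smooth projective family `f : 𝒳 ⟶ S` (`𝒳`, `S` quasi-projective, `S`
  smooth and irreducible) and a global class `A ∈ H²ᵖ(𝒳(ℂ); ℂ)`, if `A|_{𝒳_t}` is algebraic for all `t`
  in a non-empty open subset of `S(ℂ)`, then `A|_{𝒳_t}` is algebraic for EVERY `t ∈ S(ℂ)`.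
* `BlochSemiregularSpread.forall_mem_algebraicClasses` — **Bloch (7.4), class level, global**: granted
  `BlochSemiregularSpread n p` and the algebraicity-locus fact, under the hypotheses of
  `BlochSemiregularSpread` (a Bloch-semiregular integral local complete intersection `Z ↪ X₀ ≅ 𝒳_{s₀}` of
  codimension `p`, a class `x` supported on `Z`, a global class `W` fibrewise rational of type `(p,p)`
  restricting to `x` at `s₀`) with `S` irreducible, `W|_{𝒳_t}` is algebraic for ALL `t ∈ S(ℂ)`.

## What is NOT here

Nothing new is assumed: both inputs are existing named facts of the tree, supplied as hypotheses
`(hB : BlochSemiregularSpread n p)`, `(hCS : charlesSchnell_algebraicityLocus_iUnion_closed)`. Not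
here: the object-level statement (an `S`-flat family of subschemes; `Bloch1972_semiregularSubschemeLifts`
in `BlochSemiregularityTheorem.lean`), BF Thm. 5.1 for sheaves (`SemiregularVariationalHodge*.lean`,
whose global form is the claim-fact `Perry2026_semiregular_remainsAlgebraic`), and irreducibility of a
smooth connected `S` (taken as the hypothesis `IrreducibleSpace S.left`).

## References

* [Bloch1972Semiregularity] S. Bloch, Semi-regularity and de Rham cohomology, Invent. Math. 17 (1972)
  51–66: Thm. (7.4) (p. 65) and the last paragraph of its proof; Remark (7.5).
* [BuchweitzFlenner2003] R.-O. Buchweitz, H. Flenner, A semiregularity map for modules and applications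
  to deformations, Compositio Math. 137 (2003) 135–210: Thm. 5.2 (p. 175).
* [CharlesSchnell2014Notes] F. Charles, C. Schnell, Notes on absolute Hodge classes, proof of
  Prop. 11.3.11.
* [VoisinHodgeII2003] C. Voisin, Hodge Theory and Complex Algebraic Geometry II, §3.3.1.
-/

noncomputable section

open CategoryTheory AlgebraicGeometry Set
open _root_.Topology

/-! ### "Since `U ⊂ T`, it follows that `T = S`" (Baire on `S(ℂ)`) -/

namespace Literature.AlgebraicGeometry.Motives.ComplexPoints

variable {S : SchemeOver ℂ}

/-- **A non-empty analytic open set is not covered by countably many proper Zariski-closed subsets**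
(Bloch 1972, proof of Thm. (7.4), last paragraph: "`T` […] is contained in a countable union of closed
subvarieties of `S`. Since `U ⊂ T`, it follows that `T = S`"): for `S` irreducible, separated and
locally of finite type over `ℂ`, if an open `U ≠ ∅` of `S(ℂ)` lies in `⋃ⱼ Wⱼ(ℂ)` with all `Wⱼ ⊆ S`
Zariski-closed, then some `Wⱼ` is all of `S` — otherwise the complex points off all the `Wⱼ` are dense
(Baire, `dense_setOf_forall_pt_not_mem`) and meet `U`.
[cite: Bloch1972Semiregularity, proof of Thm. (7.4), last paragraph (p. 65)]
[cite: VoisinHodgeII2003, §3.3.1] -/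
theorem exists_eq_univ_of_isOpen_subset_iUnion [IsSeparated S.hom] [LocallyOfFiniteType S.hom]
    [IrreducibleSpace S.left] {ι : Type*} [Countable ι] {W : ι → Set S.left}
    (hW : ∀ j, IsClosed (W j)) {U : Set (ComplexPoints S)} (hU : IsOpen U) (hUne : U.Nonempty)
    (hUW : U ⊆ ⋃ j, {t : ComplexPoints S | t.pt ∈ W j}) : ∃ j, W j = univ := by
  by_contra h
  push Not at h
  have hd : Dense {t : ComplexPoints S | ∀ j, t.pt ∉ W j} := dense_setOf_forall_pt_not_mem hW h
  obtain ⟨t, htU, ht⟩ := hd.inter_open_nonempty U hU hUne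
  obtain ⟨j, hj⟩ := mem_iUnion.1 (hUW htU)
  exact ht j hj

end Literature.AlgebraicGeometry.Motives.ComplexPoints

namespace Literature.AlgebraicGeometry.HodgeTheory

section Global

open Literature.AlgebraicGeometry.Motives

variable {𝒳 S : SchemeOver ℂ}

local notation3 (prettyPrint := false) "Res[" f ", " s ", " k ", " A "]" =>
  complexBetti.map (Motives.fiberι f s) k A

/-- **Algebraic on a non-empty open set ⇒ algebraic everywhere** (Bloch 1972, proof of (7.4), last
paragraph), granted the structure theorem on algebraicity loci: for a smooth projective family
`f : 𝒳 ⟶ S` of relative dimension `n` with `𝒳`, `S` quasi-projective and `S` smooth and IRREDUCIBLE,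
and a global class `A ∈ H²ᵖ(𝒳(ℂ); ℂ)`, if `A|_{𝒳_t}` is an algebraic class for every `t` in some
non-empty open `U ⊆ S(ℂ)`, then `A|_{𝒳_t}` is algebraic for every `t ∈ S(ℂ)`: the algebraicity locus
is `⋃ⱼ Wⱼ(ℂ)` with `Wⱼ ⊆ S` closed (the fact), it contains `U`, so some `Wⱼ = S`
(`ComplexPoints.exists_eq_univ_of_isOpen_subset_iUnion`).
[cite: Bloch1972Semiregularity, proof of Thm. (7.4), last paragraph (p. 65)]
[cite: CharlesSchnell2014Notes, Prop. 11.3.11 (proof)] -/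
theorem charlesSchnell_algebraicityLocus_iUnion_closed.forall_mem_algebraicClasses_of_isOpen
    (hCS : charlesSchnell_algebraicityLocus_iUnion_closed) (f : 𝒳 ⟶ S) (n p : ℕ)
    (h𝒳 : IsQuasiProjectiveOver 𝒳) (hS : IsQuasiProjectiveOver S)
    (hSm : _root_.AlgebraicGeometry.Smooth S.hom) (hf : IsSmoothProjectiveFamily f n)
    [IrreducibleSpace S.left] (A : complexBetti 𝒳 (2 * p)) {U : Set (ComplexPoints S)}
    (hU : IsOpen U) (hUne : U.Nonempty)
    (hUA : ∀ t ∈ U, Res[f, t, 2 * p, A] ∈ algebraicClasses (fiberOver f t) p) (t : ComplexPoints S) :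
    Res[f, t, 2 * p, A] ∈ algebraicClasses (fiberOver f t) p := by
  haveI : LocallyOfFiniteType S.hom := hS.locallyOfFiniteType
  haveI : IsSeparated S.hom := by
    obtain ⟨P, j, hP, hj⟩ := hS
    haveI := hj
    haveI : IsProper P.hom := hP.isProper
    rw [← Over.w j]
    infer_instance
  obtain ⟨W, hW, hL⟩ := hCS f n p h𝒳 hS hSm hf A
  have hUW : U ⊆ ⋃ j, {t : ComplexPoints S | t.pt ∈ W j} := by
    rw [← hL]
    exact fun t ht => hUA t ht
  obtain ⟨j, hj⟩ := ComplexPoints.exists_eq_univ_of_isOpen_subset_iUnion hW hU hUne hUW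
  have ht : t ∈ ⋃ j, {t : ComplexPoints S | t.pt ∈ W j} := mem_iUnion.2 ⟨j, by simp [hj]⟩
  rw [← hL] at ht
  exact ht

/-- **Bloch 1972, Thm. (7.4) — class level, GLOBAL over an irreducible base.** Printed: "Let
`X →ᶠ S →ᵍ Spec(ℂ)` be morphisms, with `f` smooth and projective and `g` smooth, connected, and of
finite type. Let `z ∈ Γ(S, R^{2p}f_*(Ω•_{X/S}))` be a horizontal section and let `o ∈ S`. Suppose the
restricted class `z₀ ∈ H^{2p}_{DR}(X₀/ℂ)` is algebraic, representing a local complete intersection,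
`Z₀ ⊂ X₀` which is semi-regular in `X₀`. Then for all `s ∈ S`, `z_s ∈ H^{2p}_{DR}(X_s/ℂ)` is
algebraic." Rendering: the hypotheses of the named fact `BlochSemiregularSpread n p` (module docstring
of `BlochSemiregularSpread.lean`: a smooth projective family `f : 𝒳 ⟶ S` of relative dimension `n` over
a smooth quasi-projective `S`, `e : X₀ ≅ 𝒳_{s₀}`, an integral Bloch-semiregular local complete
intersection `i : Z ↪ X₀` of codimension `p`, a class `x` supported on `Z`, a global class `W`
fibrewise rational of type `(p,p)` — the horizontal section `z` — with `e^*(W|_{𝒳_{s₀}}) = x`) plus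
`S` irreducible ("smooth, connected"); conclusion: `W|_{𝒳_t}` is algebraic for EVERY `t ∈ S(ℂ)`.
Proof = Bloch's: `BlochSemiregularSpread` gives an open `U ∋ s₀` of algebraicity, and
`charlesSchnell_algebraicityLocus_iUnion_closed.forall_mem_algebraicClasses_of_isOpen` spreads it.
[cite: Bloch1972Semiregularity, Thm. (7.4) (p. 65) with its proof and Remark (7.5)]
[cite: BuchweitzFlenner2003, Thm. 5.2 (p. 175)]
[cite: CharlesSchnell2014Notes, Prop. 11.3.11 (proof)] -/
theorem BlochSemiregularSpread.forall_mem_algebraicClasses {n p : ℕ} (hB : BlochSemiregularSpread n p)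
    (hCS : charlesSchnell_algebraicityLocus_iUnion_closed)
    (X₀ : SchemeOver ℂ) (Z : Scheme.{0}) (i : Z ⟶ X₀.left) (x : complexBetti X₀ (2 * p))
    (f : 𝒳 ⟶ S) (s₀ : ComplexPoints S) (e : X₀ ≅ fiberOver f s₀) (W : complexBetti 𝒳 (2 * p))
    (hi : IsClosedImmersion i) (hreg : IsRegularImmersionOfCodim i p)
    (hZ : AlgebraicGeometry.IsIntegral Z) (hcodim : ∀ z ∈ Set.range i.base, (p : ℕ∞) ≤ Order.coheight z)
    (hsr : IsBlochSemiregular i n p) (hx : x ∈ classesSupportedOn X₀ (Set.range i.base) (2 * p))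
    (hf : IsSmoothProjectiveFamily f n) (h𝒳 : IsQuasiProjectiveOver 𝒳) (hS : IsQuasiProjectiveOver S)
    (hSm : _root_.AlgebraicGeometry.Smooth S.hom) [IrreducibleSpace S.left]
    (hW : ∀ s : ComplexPoints S, IsRationalClass (Res[f, s, 2 * p, W]) ∧
      IsOfHodgeType n (fiberOver f s) (2 * p) p p (Res[f, s, 2 * p, W]))
    (hWx : complexBetti.map e.hom (2 * p) (Res[f, s₀, 2 * p, W]) = x) (t : ComplexPoints S) :
    Res[f, t, 2 * p, W] ∈ algebraicClasses (fiberOver f t) p := by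
  obtain ⟨U, hU, hs₀, hUA⟩ :=
    hB X₀ Z i x 𝒳 S f s₀ e W hi hreg hZ hcodim hsr hx hf h𝒳 hS hSm hW hWx
  exact hCS.forall_mem_algebraicClasses_of_isOpen f n p h𝒳 hS hSm hf W hU ⟨s₀, hs₀⟩ hUA t

end Global

end Literature.AlgebraicGeometry.HodgeTheory

end
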